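import Summits.CriticalPhenomena.PercolationContinuityZ3.Theorems.PercNearOneGluingNoHeavyQuantBlockCombHalfClass
import HarnessLib

/-!
# QUANT lane R8, FAR on trees: THE BLOCK-COMB ROW — FAR at every layer for EVERY block-comb under the weak hypothesis `EN > 2j`
# (canonical model; rung R8 of `run/shared/lean/prim/quant/LADDER.md` for the block-comb class, complete)

builds on p205010 (kernel theorem, internal audit signed; external expert review pending)

Support file (`--supports stmt-CriticalPhenomena-4575`), QUANT lane seat prim-quant-p1 (gen 9); memo
`run/shared/lean/prim/quant/P1-SURPLUS.md` §20.  Theorems only (local notation, no definitions), no sorries, standard axioms.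
Model and notation: `…QuantBlockCombMergeModel.lean` (chain gates `q`, levels `lv`, sizes `a`, private gates `g`, explicit tail
`TAIL = P(N ≥ j+1)`, marginal of blob `k` = `(∏_{i<lv k} q i)·g k`, total size `A = Σ_k a k`, mean `EN = Σ_k a k·marginal k`).
Tool: the HALF-CLASS theorem `Quant.BlockComb.tail_ge_of_halfClass` (`…QuantBlockCombHalfClass.lean`, same seat).

* `Quant.BlockComb.marg_eq_depth_sum` — the marginal of a blob as a depth/configuration sum (the identity inside `tail_ge_marg_of_giant`).
* `Quant.BlockComb.mean_le_markov` — **MARKOV ON THE DEFICIT**: `EN ≤ j + (A − j)·TAIL`, i.e. `P(N ≤ j) = P(A − N ≥ A − j) ≤ E(A − N)/(A − j)`: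
  pointwise `mass ≤ j + (A − j)·𝟙[mass ≥ j+1]`, summed against the depth law and the product weights.  Hence `TAIL > j/(A − j)` whenever
  `EN > 2j`.
* **`Quant.BlockComb.tail_ge_of_le_marg_of_mean` — THE BLOCK-COMB ROW.**  Chain gates and private gates in `[0,1]`, live levels `≤ D`, `x` at most every
  live marginal, and `2j < EN`.  Then `x ≤ TAIL[D, q, lv, a, g, j] = P(N ≥ j+1)`.  PROOF — a dichotomy: EITHER every live private gate is
  `≥ j/(A − j)` and the half-class theorem (merge induction: normal form by raising the first chain gate, the tied root blob merges by the
  law-free merge step, contraction, block-star base `IndepBlob.far_indepBlob`) gives `x ≤ TAIL`; OR some live blob has `g k·(A − j) < j`, and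
  then `x ≤ marginal k ≤ g k < j/(A − j) < TAIL` by Markov.  In LEAD-NOTES-G13 N24 (4)'s language: after the law-free moves a minimal
  counterexample has a tied root blob `τ` with `x·(A − a τ) < j`, hence `x < j/(A − j)` — and Markov's inequality alone gives `TAIL > j/(A − j)`.
  This is the far-relay row `Quant.FarRelayRow` at every layer for every tree-supported weight pattern with a block-comb presentation
  (LEAD-NOTES-G10 N21 (0): the least likely relay's chain with blobs on private gates), in p1 g8's canonical coordinates; the gate-coordinate
  (`Quant.FarTreeRow`) and route-vocabulary (`Quant.FarRelayRow`) wrappers follow the pattern of `…QuantFarTreeBlockCombStrong.lean` /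
  `…QuantFarRelayRowBlockCombStrong.lean` with `tail_ge_of_le_marg_of_mean` in place of `tail_ge_of_le_marg_strong` (typer).  Previously kernel: the strong
  regime (p242699), the class (p243788), two-plateau single-root-block families (lead g13), the light-merge and half-class regimes (this seat).
* `Quant.BlockComb.tail_ge_prod_of_mean` — the form with `x = ∏_{i<D} q i` (the terminal marginal, the row's normal form).
SIMULTANEOUS INDEPENDENT PROOF: `Quant.BlockComb.tail_ge_of_mean` (prim-quant-census-1 gen 13, `…QuantBlockCombGeneralRow.lean`, p247138, landed one
minute before this file's first submission) is the same row in floor form (`0 < x = ∏ q`), by one induction interleaving class / giant / Markov /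
merge / split / raise; this file's `tail_ge_of_le_marg_of_mean` takes any `x` below the live marginals and is the two-case dichotomy HALF-CLASS
(p246929) ∨ MARKOV.  Either can serve the route-vocabulary transport `…QuantFarRelayRowBlockCombRow.lean`.
Honest scope: block-combs only (the relay-free vertices of the tree form a CHAIN); general trees / all-tied forests with two relay-free roots
(P1-SURPLUS §19.4 (GM)) are not covered by this file.
-/

namespace Summit.CriticalPhenomena.PercolationContinuityZ3.Theorems

namespace Quant

namespace BlockComb

open Finset

variable {κ : Type*} [Fintype κ] [DecidableEq κ]

/-- product-Bernoulli weight of the set `S` of open blob gates -/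
local notation3 "wt[" g ", " S "]" => ∏ k, (if k ∈ (S : Finset κ) then (g : κ → ℝ) k else 1 - (g : κ → ℝ) k)

/-- probability that the chain `q` of length `D` is open exactly to depth `i` -/
local notation3 "pd[" D ", " q ", " i "]" =>
  (∏ i' ∈ Finset.range (i : ℕ), (q : ℕ → ℝ) i') * (if (i : ℕ) < (D : ℕ) then 1 - (q : ℕ → ℝ) i else 1)

/-- mass counted at depth `i` in blob configuration `S` -/
local notation3 "mass[" lv ", " a ", " i ", " S "]" =>
  ∑ k ∈ (S : Finset κ).filter (fun k => (lv : κ → ℕ) k ≤ (i : ℕ)), ((a : κ → ℕ) k : ℕ)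

/-- the tail `P(N ≥ j+1)` of the block-comb count, as an explicit finite sum -/
local notation3 "TAIL[" D ", " q ", " lv ", " a ", " g ", " j "]" =>
  ∑ i ∈ Finset.range ((D : ℕ) + 1), pd[D, q, i] *
    ∑ S : Finset κ, wt[g, S] * (if (j : ℕ) + 1 ≤ mass[lv, a, i, S] then (1 : ℝ) else 0)

/-! ### 1. The mean as a depth/configuration sum; Markov on the deficit -/

/-- **The marginal of blob `k` as a depth/configuration sum**: `(∏_{i<lv k} q i)·g k = Σ_{i ≤ D} pd i·Σ_S wt S·𝟙[k ∈ S, lv k ≤ i]`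
(`lv k ≤ D`). [folklore] -/
theorem marg_eq_depth_sum (D : ℕ) (q : ℕ → ℝ) (lv : κ → ℕ) (g : κ → ℝ) (k : κ) (hlvk : lv k ≤ D) :
    (∏ i ∈ Finset.range (lv k), q i) * g k =
      ∑ i ∈ Finset.range (D + 1), pd[D, q, i] *
        ∑ S : Finset κ, wt[g, S] * (if k ∈ S ∧ lv k ≤ i then (1 : ℝ) else 0) := by
  have hinner : ∀ i, ∑ S : Finset κ, wt[g, S] * (if k ∈ S ∧ lv k ≤ i then (1 : ℝ) else 0) = (if lv k ≤ i then g k else 0) := by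
    intro i
    by_cases hi : lv k ≤ i
    · rw [if_pos hi, ← sum_wt_mem g k]
      refine Finset.sum_congr rfl fun S _ => ?_
      by_cases hkS : k ∈ S
      · rw [if_pos ⟨hkS, hi⟩, if_pos hkS]
      · rw [if_neg (fun h => hkS h.1), if_neg hkS]
    · rw [if_neg hi]
      exact Finset.sum_eq_zero fun S _ => by rw [if_neg (fun h => hi h.2), mul_zero]
  simp_rw [hinner]
  rw [← pd_tail_sum q D (lv k) hlvk, Finset.sum_filter, Finset.sum_mul]
  refine Finset.sum_congr rfl fun i _ => ?_
  by_cases hi : lv k ≤ i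
  · rw [if_pos hi, if_pos hi]
  · rw [if_neg hi, if_neg hi, zero_mul, mul_zero]

/-- The counted mass at depth `i`, cast to `ℝ`, as a sum of indicators over all blobs. [folklore] -/
theorem mass_cast_eq_sum_ite (lv : κ → ℕ) (a : κ → ℕ) (i : ℕ) (S : Finset κ) :
    ((mass[lv, a, i, S] : ℕ) : ℝ) = ∑ k, (a k : ℝ) * (if k ∈ S ∧ lv k ≤ i then (1 : ℝ) else 0) := by
  push_cast
  have hset : S.filter (fun k => lv k ≤ i) = Finset.univ.filter (fun k => k ∈ S ∧ lv k ≤ i) := by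
    ext k; simp only [Finset.mem_filter, Finset.mem_univ, true_and]
  rw [hset, Finset.sum_filter]
  refine Finset.sum_congr rfl fun k _ => ?_
  split_ifs <;> simp

/-- **The mean as a depth/configuration sum**: `Σ_k a k·marginal k = Σ_{i ≤ D} pd i·Σ_S wt S·mass_i S` (live levels `≤ D`). [folklore] -/
theorem mean_eq_depth_sum (D : ℕ) (q : ℕ → ℝ) (lv : κ → ℕ) (a : κ → ℕ) (g : κ → ℝ) (hlv : ∀ k, 0 < a k → lv k ≤ D) :
    ∑ k, (a k : ℝ) * ((∏ i ∈ Finset.range (lv k), q i) * g k) =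
      ∑ i ∈ Finset.range (D + 1), pd[D, q, i] * ∑ S : Finset κ, wt[g, S] * ((mass[lv, a, i, S] : ℕ) : ℝ) := by
  -- blob by blob
  have hk : ∀ k, (a k : ℝ) * ((∏ i ∈ Finset.range (lv k), q i) * g k) =
      ∑ i ∈ Finset.range (D + 1), pd[D, q, i] *
        ∑ S : Finset κ, wt[g, S] * ((a k : ℝ) * (if k ∈ S ∧ lv k ≤ i then (1 : ℝ) else 0)) := by
    intro k
    by_cases hak : 0 < a k
    · rw [marg_eq_depth_sum D q lv g k (hlv k hak), Finset.mul_sum]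
      refine Finset.sum_congr rfl fun i _ => ?_
      rw [Finset.mul_sum, Finset.mul_sum, Finset.mul_sum]
      refine Finset.sum_congr rfl fun S _ => ?_
      ring
    · have h0 : a k = 0 := by omega
      rw [h0]; simp
  rw [Finset.sum_congr rfl fun k _ => hk k, Finset.sum_comm]
  refine Finset.sum_congr rfl fun i _ => ?_
  rw [← Finset.mul_sum]
  congr 1
  rw [Finset.sum_comm]
  refine Finset.sum_congr rfl fun S _ => ?_
  rw [← Finset.mul_sum, mass_cast_eq_sum_ite lv a i S]

/-- **MARKOV ON THE DEFICIT.**  For chain and private gates in `[0,1]` and live levels `≤ D`: `EN ≤ j + (A − j)·TAIL`, i.e.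
`P(N ≤ j)·(A − j) ≤ E(A − N)`; pointwise `mass ≤ j + (A − j)·𝟙[mass ≥ j+1]` because the counted mass never exceeds `A`. [folklore] -/
theorem mean_le_markov (D : ℕ) (q : ℕ → ℝ) (hq : ∀ i, 0 ≤ q i ∧ q i ≤ 1) (lv : κ → ℕ) (a : κ → ℕ)
    (g : κ → ℝ) (hg : ∀ k, 0 ≤ g k ∧ g k ≤ 1) (j : ℕ) (hlv : ∀ k, 0 < a k → lv k ≤ D) :
    ∑ k, (a k : ℝ) * ((∏ i ∈ Finset.range (lv k), q i) * g k) ≤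
      (j : ℝ) + ((∑ k, (a k : ℝ)) - j) * TAIL[D, q, lv, a, g, j] := by
  rw [mean_eq_depth_sum D q lv a g hlv]
  -- pointwise bound
  have hpt : ∀ (i : ℕ) (S : Finset κ), ((mass[lv, a, i, S] : ℕ) : ℝ) ≤
      (j : ℝ) + ((∑ k, (a k : ℝ)) - j) * (if j + 1 ≤ mass[lv, a, i, S] then (1 : ℝ) else 0) := by
    intro i S
    have hle : mass[lv, a, i, S] ≤ ∑ k, a k :=
      (Finset.sum_le_sum_of_subset_of_nonneg (Finset.filter_subset _ S) (fun _ _ _ => Nat.zero_le _)).trans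
        (Finset.sum_le_sum_of_subset_of_nonneg (Finset.subset_univ S) (fun _ _ _ => Nat.zero_le _))
    have hleR : ((mass[lv, a, i, S] : ℕ) : ℝ) ≤ ∑ k, (a k : ℝ) := by exact_mod_cast hle
    by_cases h : j + 1 ≤ mass[lv, a, i, S]
    · rw [if_pos h, mul_one]; linarith
    · rw [if_neg h, mul_zero, add_zero]; exact_mod_cast (by omega : mass[lv, a, i, S] ≤ j)
  -- sum it against the (nonnegative) depth law and weights
  have hsum : ∑ i ∈ Finset.range (D + 1), pd[D, q, i] * ∑ S : Finset κ, wt[g, S] * ((mass[lv, a, i, S] : ℕ) : ℝ) ≤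
      ∑ i ∈ Finset.range (D + 1), pd[D, q, i] * ∑ S : Finset κ, wt[g, S] *
        ((j : ℝ) + ((∑ k, (a k : ℝ)) - j) * (if j + 1 ≤ mass[lv, a, i, S] then (1 : ℝ) else 0)) :=
    Finset.sum_le_sum fun i _ => mul_le_mul_of_nonneg_left
      (Finset.sum_le_sum fun S _ => mul_le_mul_of_nonneg_left (hpt i S) (wt_nonneg g hg S)) (pd_nonneg D q hq i)
  refine hsum.trans (le_of_eq ?_)
  -- evaluate: `Σ_S wt = 1`, `Σ_i pd = 1`
  have hwt : ∑ S : Finset κ, wt[g, S] = 1 := IndepBlob.sum_bernoulliWeight g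
  have hpd : ∑ i ∈ Finset.range (D + 1), pd[D, q, i] = 1 := by
    have h := pd_tail_sum q D 0 (Nat.zero_le D)
    rw [Finset.filter_true_of_mem (fun i _ => Nat.zero_le i), Finset.prod_range_zero] at h
    exact h
  have hinner : ∀ i, ∑ S : Finset κ, wt[g, S] *
      ((j : ℝ) + ((∑ k, (a k : ℝ)) - j) * (if j + 1 ≤ mass[lv, a, i, S] then (1 : ℝ) else 0)) =
        (j : ℝ) + ((∑ k, (a k : ℝ)) - j) * ∑ S : Finset κ, wt[g, S] * (if j + 1 ≤ mass[lv, a, i, S] then (1 : ℝ) else 0) := by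
    intro i
    simp_rw [mul_add, Finset.sum_add_distrib]
    rw [← Finset.sum_mul, hwt, one_mul, Finset.mul_sum]
    congr 1
    exact Finset.sum_congr rfl fun S _ => by ring
  simp_rw [hinner, mul_add, Finset.sum_add_distrib]
  rw [← Finset.sum_mul, hpd, one_mul, Finset.mul_sum]
  congr 1
  exact Finset.sum_congr rfl fun i _ => by ring

/-! ### 2. The block-comb row -/

/-- **THEOREM (THE BLOCK-COMB ROW: FAR at every layer for every block-comb under `EN > 2j`, canonical model).**  Chain gates and private
gates in `[0,1]`, live levels `≤ D`, `x` at most every live marginal `(∏_{i<lv k} q i)·g k`, and `2j < Σ_k a k·marginal k` (the mean of the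
relay count exceeds `2j`).  Then `x ≤ TAIL[D, q, lv, a, g, j] = P(N ≥ j+1)`.  Dichotomy: every live private gate `≥ j/(A − j)` ⟹ the
half-class theorem; some live gate `< j/(A − j)` ⟹ `x < j/(A − j) < TAIL` by Markov on the deficit. [this work] -/
theorem tail_ge_of_le_marg_of_mean (D : ℕ) (q : ℕ → ℝ) (hq : ∀ i, 0 ≤ q i ∧ q i ≤ 1) (lv : κ → ℕ) (a : κ → ℕ)
    (g : κ → ℝ) (hg : ∀ k, 0 ≤ g k ∧ g k ≤ 1) (j : ℕ) (hlv : ∀ k, 0 < a k → lv k ≤ D) (x : ℝ)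
    (hx : ∀ k, 0 < a k → x ≤ (∏ i ∈ Finset.range (lv k), q i) * g k)
    (hmean : (2 * j : ℝ) < ∑ k, (a k : ℝ) * ((∏ i ∈ Finset.range (lv k), q i) * g k)) :
    x ≤ TAIL[D, q, lv, a, g, j] := by
  by_cases hhalf : ∀ k, 0 < a k → (j : ℝ) ≤ g k * ((∑ k', (a k' : ℝ)) - j)
  · exact tail_ge_of_halfClass D q hq lv a g hg j hlv x hx hmean hhalf
  · push Not at hhalf
    obtain ⟨k, hk, hlt⟩ := hhalf
    set A : ℝ := ∑ k', (a k' : ℝ) with hA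
    have hmk := mean_le_markov D q hq lv a g hg j hlv
    -- `2j < EN ≤ A`, so `A − j > 0`
    have hENle : ∑ k, (a k : ℝ) * ((∏ i ∈ Finset.range (lv k), q i) * g k) ≤ A :=
      Finset.sum_le_sum fun k _ => by
        have h1 : (∏ i ∈ Finset.range (lv k), q i) * g k ≤ 1 := mul_le_one₀ (prefixProd_mem q hq (lv k)).2 (hg k).1 (hg k).2
        have := mul_le_mul_of_nonneg_left h1 (Nat.cast_nonneg (a k))
        rwa [mul_one] at this
    have hAj : (0 : ℝ) < A - j := by
      have : (0 : ℝ) ≤ j := Nat.cast_nonneg j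
      linarith
    -- `x ≤ marginal k ≤ g k`, and `g k·(A − j) < j < (A − j)·TAIL`
    have hxg : x ≤ g k :=
      (hx k hk).trans (by
        have := mul_le_mul_of_nonneg_right (prefixProd_mem q hq (lv k)).2 (hg k).1
        rwa [one_mul] at this)
    have h1 : (j : ℝ) < (A - j) * TAIL[D, q, lv, a, g, j] := by linarith
    have h2 : x * (A - j) < (A - j) * TAIL[D, q, lv, a, g, j] := by
      have h3 : x * (A - j) ≤ g k * (A - j) := mul_le_mul_of_nonneg_right hxg hAj.le
      linarith
    by_contra hcon
    push Not at hcon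
    have := mul_le_mul_of_nonneg_left hcon.le hAj.le
    linarith

/-- **COROLLARY (the block-comb row in normal form).**  Chain of `D` gates, live levels `≤ D`, every live marginal at least the terminal marginal
`x = ∏_{i<D} q i`, and `EN > 2j`; then `∏_{i<D} q i ≤ P(N ≥ j+1)`. [this work] -/
theorem tail_ge_prod_of_mean (D : ℕ) (q : ℕ → ℝ) (hq : ∀ i, 0 ≤ q i ∧ q i ≤ 1) (lv : κ → ℕ) (a : κ → ℕ)
    (g : κ → ℝ) (hg : ∀ k, 0 ≤ g k ∧ g k ≤ 1) (j : ℕ) (hlv : ∀ k, 0 < a k → lv k ≤ D)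
    (hx : ∀ k, 0 < a k → ∏ i ∈ Finset.range D, q i ≤ (∏ i ∈ Finset.range (lv k), q i) * g k)
    (hmean : (2 * j : ℝ) < ∑ k, (a k : ℝ) * ((∏ i ∈ Finset.range (lv k), q i) * g k)) :
    ∏ i ∈ Finset.range D, q i ≤ TAIL[D, q, lv, a, g, j] :=
  tail_ge_of_le_marg_of_mean D q hq lv a g hg j hlv _ hx hmean

end BlockComb

end Quant

end Summit.CriticalPhenomena.PercolationContinuityZ3.Theorems
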